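import Mathlib
import Summits.MatrixMultiplication.MatrixMultiplication.Theorems.AbelianSTPPSieveVP

/-!
# Rules U11-G / U11-P are hereditary (sub-family monotonicity)

Support file for the abelian STPP census of cell mm-stpp (rung F-M1; candidate route `AbelianSTPPCensusVP`,
crux `ShapeExclusionVP337` = certificate replay of a depth-first search over shape multisets).  A DFS that prunes a
PARTIAL shape list by rule U11-G or U11-P is sound only if the rules are hereditary: a super-list of a dead list
is dead, equivalently the rules pass from a shape list to every sub-list (HOME/mm-stpp-lit/POLLARD-KILLS.md §3
«HEREDITARY (node rule)», REF [52]; the planner's engine `feas_scan_vP.py` and any kernel checker rely on it).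

For an injective re-indexing `φ : Fin K ↪ Fin N` (the sub-list `(a ∘ φ, b ∘ φ, c ∘ φ)` of `(a, b, c)`):
* `sum_comp_le` — `Σ_k f(φ k) ≤ Σ_i f i`; hence `pAB`, `pBC`, `pCA`, `lB` of the sub-list are at most those
  of the list (`pAB_comp_le`, …, `lB_comp_le`);
* `ubB_le_ubB_comp` — the ceiling is ANTITONE: `UB_B(t)` of the list is at most `UB_B(t)` of the sub-list,
  provided `P_CA ≤ M` (no truncation in `t·(M − P_CA)`; each removed member trades `a c·min(t,b) ≤ t·ca`);
* `u11GFormB_comp`, `u11PFormB_comp` — form B of U11-G / U11-P passes to sub-lists (given `P_CA ≤ M`);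
* `u11G_comp`, `u11P_comp` — all three letter forms (given the three packing inequalities `P_AB, P_BC, P_CA ≤ M`,
  which every `SieveAdmissible` list and every STPP shape list satisfies).

WHAT THIS IS NOT: arithmetic about the typed rules only — no STPP family, no `ω` statement, no census verdict.
-/

-- single-conjunct summit: the mandated namespace repeats `MatrixMultiplication`.
set_option linter.dupNamespace false

namespace Summit.MatrixMultiplication.MatrixMultiplication.Theorems

namespace VPRules

open Finset

variable {N K : ℕ}

/-- A sum over an injective re-indexing is at most the full sum (naturals). [folklore] -/
theorem sum_comp_le (φ : Fin K ↪ Fin N) (f : Fin N → ℕ) : ∑ k, f (φ k) ≤ ∑ i, f i := by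
  rw [← sum_map univ φ f]
  exact sum_le_sum_of_subset (subset_univ _)

/-- The full sum splits as the re-indexed sum plus the sum over the unused indices. [folklore] -/
theorem sum_eq_sum_comp_add (φ : Fin K ↪ Fin N) (f : Fin N → ℕ) :
    ∑ i, f i = ∑ k, f (φ k) + ∑ i ∈ (univ.map φ)ᶜ, f i := by
  rw [← sum_map univ φ f, sum_add_sum_compl]

/-- `P_AB` of a sub-list is at most `P_AB` of the list. [original] -/
theorem pAB_comp_le (φ : Fin K ↪ Fin N) (a b c : Fin N → ℕ) :
    pAB (a ∘ φ) (b ∘ φ) (c ∘ φ) ≤ pAB a b c :=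
  sum_comp_le φ fun i => a i * b i

/-- `P_BC` of a sub-list is at most `P_BC` of the list. [original] -/
theorem pBC_comp_le (φ : Fin K ↪ Fin N) (a b c : Fin N → ℕ) :
    pBC (a ∘ φ) (b ∘ φ) (c ∘ φ) ≤ pBC a b c :=
  sum_comp_le φ fun i => b i * c i

/-- `P_CA` of a sub-list is at most `P_CA` of the list. [original] -/
theorem pCA_comp_le (φ : Fin K ↪ Fin N) (a b c : Fin N → ℕ) :
    pCA (a ∘ φ) (b ∘ φ) (c ∘ φ) ≤ pCA a b c :=
  sum_comp_le φ fun i => c i * a i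

/-- The fibre budget `L_B(t)` of a sub-list is at most that of the list. [original] -/
theorem lB_comp_le (φ : Fin K ↪ Fin N) (a b c : Fin N → ℕ) (t : ℕ) :
    lB (a ∘ φ) (b ∘ φ) (c ∘ φ) t ≤ lB a b c t :=
  sum_comp_le φ fun i => if b i < t then b i * min (a i) (c i) else 0

/-- **The ceiling is antitone.** If `P_CA ≤ M` for the list, then `UB_B(t)` of the list is at most `UB_B(t)` of
any sub-list: each removed member `i` contributes `aᵢcᵢ·min(t,bᵢ) ≤ t·cᵢaᵢ` to the first sum and removes
`t·cᵢaᵢ` from `t·(M − P_CA)`. [original] -/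
theorem ubB_le_ubB_comp (φ : Fin K ↪ Fin N) {M : ℕ} {a b c : Fin N → ℕ} (hCA : pCA a b c ≤ M) (t : ℕ) :
    ubB M a b c t ≤ ubB M (a ∘ φ) (b ∘ φ) (c ∘ φ) t := by
  unfold ubB
  unfold pCA at hCA ⊢
  simp only [Function.comp_apply]
  rw [sum_eq_sum_comp_add φ (fun i => a i * c i * min t (b i)),
    sum_eq_sum_comp_add φ (fun i => c i * a i)] at *
  have hrem : ∑ i ∈ (univ.map φ)ᶜ, a i * c i * min t (b i) ≤ t * ∑ i ∈ (univ.map φ)ᶜ, c i * a i := by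
    rw [mul_sum]
    refine sum_le_sum fun i _ => ?_
    calc a i * c i * min t (b i) ≤ a i * c i * t := Nat.mul_le_mul_left _ (min_le_left _ _)
      _ = t * (c i * a i) := by ring
  -- `t·(M − (S + R)) + t·R = t·(M − S)` since `S + R ≤ M`
  have hsplit : t * (M - (∑ k, c (φ k) * a (φ k) + ∑ i ∈ (univ.map φ)ᶜ, c i * a i)) +
      t * ∑ i ∈ (univ.map φ)ᶜ, c i * a i = t * (M - ∑ k, c (φ k) * a (φ k)) := by
    rw [← mul_add]
    congr 1
    omega
  omega

/-- **Rule U11-G (form B) is hereditary**: it passes from a shape list with `P_CA ≤ M` to every sub-list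
(floor monotone, fibre budget monotone, ceiling antitone). [original] -/
theorem u11GFormB_comp (φ : Fin K ↪ Fin N) {M : ℕ} {a b c : Fin N → ℕ} (hCA : pCA a b c ≤ M)
    (h : U11GFormB M a b c) : U11GFormB M (a ∘ φ) (b ∘ φ) (c ∘ φ) := by
  intro t ht2 htAB htBC htL
  have hAB := pAB_comp_le φ a b c
  have hBC := pBC_comp_le φ a b c
  have hU := ubB_le_ubB_comp φ hCA t
  have hU2 := ubB_le_ubB_comp φ hCA 2
  obtain ⟨h2, h3⟩ := h t ht2 (htAB.trans hAB) (htBC.trans hBC) (htL.trans (lB_comp_le φ a b c t))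
  refine ⟨fun ht => ?_, fun ht => ?_⟩
  · have := h2 ht
    nlinarith
  · have := h3 ht
    nlinarith

/-- **Rule U11-P (form B) is hereditary**: it passes from a shape list with `P_CA ≤ M` to every sub-list.
[original] -/
theorem u11PFormB_comp (φ : Fin K ↪ Fin N) {M : ℕ} {a b c : Fin N → ℕ} (hCA : pCA a b c ≤ M)
    (h : U11PFormB M a b c) : U11PFormB M (a ∘ φ) (b ∘ φ) (c ∘ φ) := by
  intro t ht1 htAB htBC
  have hAB := pAB_comp_le φ a b c
  have hBC := pBC_comp_le φ a b c
  have hU := ubB_le_ubB_comp φ hCA t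
  have hbig := h t ht1 (htAB.trans hAB) (htBC.trans hBC)
  calc t * min M (pAB (a ∘ φ) (b ∘ φ) (c ∘ φ) + pBC (a ∘ φ) (b ∘ φ) (c ∘ φ) - t)
      ≤ t * min M (pAB a b c + pBC a b c - t) :=
        Nat.mul_le_mul_left _ (min_le_min_left _ (Nat.sub_le_sub_right (Nat.add_le_add hAB hBC) _))
    _ ≤ ubB M a b c t := hbig
    _ ≤ ubB M (a ∘ φ) (b ∘ φ) (c ∘ φ) t := hU

/-- **Rule U11-G (three letter forms) is hereditary** on lists satisfying the three packing inequalities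
`P_AB, P_BC, P_CA ≤ M` (true for every `SieveAdmissible` list and every STPP shape list). [original] -/
theorem u11G_comp (φ : Fin K ↪ Fin N) {M : ℕ} {a b c : Fin N → ℕ} (hAB : pAB a b c ≤ M)
    (hBC : pBC a b c ≤ M) (hCA : pCA a b c ≤ M) (h : U11G M a b c) :
    U11G M (a ∘ φ) (b ∘ φ) (c ∘ φ) := by
  obtain ⟨hB, hA, hC⟩ := h
  refine ⟨u11GFormB_comp φ hCA hB, u11GFormB_comp φ ?_ hA, u11GFormB_comp φ ?_ hC⟩
  · -- letters `(c, a, b)`: its `P_CA` is `Σ bᵢcᵢ = P_BC`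
    unfold pCA; unfold pBC at hBC; exact hBC
  · -- letters `(b, c, a)`: its `P_CA` is `Σ aᵢbᵢ = P_AB`
    unfold pCA; unfold pAB at hAB; exact hAB

/-- **Rule U11-P (three letter forms) is hereditary** on lists satisfying the three packing inequalities.
[original] -/
theorem u11P_comp (φ : Fin K ↪ Fin N) {M : ℕ} {a b c : Fin N → ℕ} (hAB : pAB a b c ≤ M)
    (hBC : pBC a b c ≤ M) (hCA : pCA a b c ≤ M) (h : U11P M a b c) :
    U11P M (a ∘ φ) (b ∘ φ) (c ∘ φ) := by
  obtain ⟨hB, hA, hC⟩ := h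
  refine ⟨u11PFormB_comp φ hCA hB, u11PFormB_comp φ ?_ hA, u11PFormB_comp φ ?_ hC⟩
  · unfold pCA; unfold pBC at hBC; exact hBC
  · unfold pCA; unfold pAB at hAB; exact hAB

end VPRules

end Summit.MatrixMultiplication.MatrixMultiplication.Theorems
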